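import Mathlib.Geometry.Manifold.PartitionOfUnity
import Mathlib.Analysis.InnerProductSpace.Basic
import HarnessLib

/-!
# Smooth vector fields in a prescribed subspace, on the positive side of a continuous field

Topic `Literature/Topology/Immersions`.  The selection step with which Eliashberg–Mishachev's
goffering begins (*Wrinkled embeddings* (2009), §2.7, proof of Lemma 2.7: *"On a neighborhood
`Op S` consider a non-vanishing vector field `v` which is transversal to `S`, defines its given
co-orientation, and horizontal, i.e. tangent to the level sets of the function `h`"*), in the
general form in which it is a smooth-partition-of-unity statement: on a σ-compact Hausdorff `C^∞`
manifold `M`, given a continuous field `N : M → F` of vectors in an inner product space (the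
co-orienting normal field of an immersed hypersurface), a subspace `K ≤ F` (the horizontal
hyperplane) and an open region `W` on whose closure `N` is nowhere orthogonal to `K` (no
horizontal tangent planes), there is a `C^∞` field `v : M → K` with `⟪v, N⟫ > 0` on `W` — the
admissible vectors at each point form a convex set, locally a constant vector is admissible, and
Mathlib's `exists_contMDiffMap_forall_mem_convex_of_local_const` glues.  A field with
`⟪v m, N m⟫ ≠ 0` is transversal to any hyperplane to which `N m` is normal
(`not_mem_of_inner_ne_zero`).

Everything is proved; no definitions, no named facts.

## References

* Y. Eliashberg, N. Mishachev, *Wrinkled embeddings*, Contemp. Math. **498** (2009), §2.7,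
  proof of Lemma 2.7 (the horizontal transversal field `v`). [EliashbergMishachev2009]
* M. W. Hirsch, *Differential Topology*, GTM 33 (1976), Ch. 2 §2 (partitions of unity and convex
  selection), Ch. 4 §5–§6 (transversal fields of hypersurfaces). [HirschDT1976]
-/

noncomputable section

open Set Function Filter
open scoped Manifold ContDiff Topology InnerProductSpace

namespace Literature.Topology.Immersions

variable {E H : Type*} [NormedAddCommGroup E] [NormedSpace ℝ E] [FiniteDimensional ℝ E]
  [TopologicalSpace H] {I : ModelWithCorners ℝ E H}
  {M : Type*} [TopologicalSpace M] [ChartedSpace H M] [IsManifold I ∞ M]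
  [SigmaCompactSpace M] [T2Space M]
  {F : Type*} [NormedAddCommGroup F] [InnerProductSpace ℝ F]

/-- **Smooth selection of a transversal field inside a subspace** (the horizontal transversal
field of Eliashberg–Mishachev's goffering): if `N : M → F` is continuous and at every point of
`closure W` some vector of the subspace `K` pairs positively with `N`, then there is a `C^∞` map
`v : M → F` with values in `K` and `⟪v m, N m⟫ > 0` for all `m ∈ W`.
[cite: EliashbergMishachev2009, §2.7 (proof of Lemma 2.7)] -/
theorem exists_contMDiff_mem_submodule_inner_pos (K : Submodule ℝ F) {N : M → F}
    (hN : Continuous N) {W : Set M} (hWN : ∀ m ∈ closure W, ∃ x ∈ K, 0 < ⟪x, N m⟫_ℝ) :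
    ∃ v : M → F, ContMDiff I 𝓘(ℝ, F) ∞ v ∧ (∀ m, v m ∈ K) ∧ ∀ m ∈ W, 0 < ⟪v m, N m⟫_ℝ := by
  -- the convex sets of admissible vectors
  let t : M → Set F := fun m => {x | x ∈ K ∧ (m ∈ W → 0 < ⟪x, N m⟫_ℝ)}
  have ht : ∀ m, Convex ℝ (t m) := by
    intro m
    by_cases hm : m ∈ W
    · have h2 : Convex ℝ {x : F | (0 : ℝ) < ⟪x, N m⟫_ℝ} := by
        have hlin : IsLinearMap ℝ fun x : F => ⟪x, N m⟫_ℝ :=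
          { map_add := fun x y => inner_add_left x y (N m)
            map_smul := fun c x => by rw [real_inner_smul_left, smul_eq_mul] }
        exact convex_halfSpace_gt hlin 0
      have : t m = (K : Set F) ∩ {x : F | (0 : ℝ) < ⟪x, N m⟫_ℝ} := by
        ext x
        simp [t, hm]
      rw [this]
      exact K.convex.inter h2
    · have : t m = (K : Set F) := by
        ext x
        simp [t, hm]
      rw [this]
      exact K.convex
  -- locally a constant vector is admissible
  have hloc : ∀ m : M, ∃ c : F, ∀ᶠ y in 𝓝 m, c ∈ t y := by
    intro m
    by_cases hm : m ∈ closure W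
    · obtain ⟨x, hxK, hx⟩ := hWN m hm
      refine ⟨x, ?_⟩
      have hc : ContinuousAt (fun y => ⟪x, N y⟫_ℝ) m := (continuous_const.inner hN).continuousAt
      filter_upwards [hc.preimage_mem_nhds (Ioi_mem_nhds hx)] with y hy
      exact ⟨hxK, fun _ => hy⟩
    · refine ⟨0, ?_⟩
      filter_upwards [isClosed_closure.isOpen_compl.mem_nhds hm] with y hy
      exact ⟨K.zero_mem, fun hyW => absurd (subset_closure hyW) hy⟩
  obtain ⟨g, hg⟩ :=
    exists_contMDiffMap_forall_mem_convex_of_local_const I (n := (⊤ : ℕ∞)) ht hloc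
  refine ⟨g, g.contMDiff, fun m => (hg m).1, fun m hm => (hg m).2 hm⟩

omit [FiniteDimensional ℝ E] [IsManifold I ∞ M] [SigmaCompactSpace M] [T2Space M] in
/-- A vector pairing non-trivially with a normal vector of a subspace is not in the subspace: if
`⟪y, N⟫ = 0` for all `y ∈ P` and `⟪x, N⟫ ≠ 0` then `x ∉ P` (transversality of the selected field
to the tangent hyperplanes). [folklore] -/
theorem not_mem_of_inner_ne_zero {P : Submodule ℝ F} {N x : F} (hP : ∀ y ∈ P, ⟪y, N⟫_ℝ = 0)
    (hx : ⟪x, N⟫_ℝ ≠ 0) : x ∉ P := fun h => hx (hP x h)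

end Literature.Topology.Immersions

end
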